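import Literature.Probability.MarkovChains.SpectralGapVariational

/-!
HONEST FRAMING: exact (Metropolis-corrected) sampling algorithms for lattice gauge theory; figures
of merit are autocorrelation/cost numbers at stated couplings and volumes; no continuum-physics
claim.

# SpectralGapOfPoincare — A POINCARÉ INEQUALITY IS A GAP FLOOR: `(∀ f, c·Var_π(f) ≤ 𝓔_P(f)) ⇒ c ≤ Gap(P)` FOR A
# REVERSIBLE CHAIN ON AT LEAST TWO STATES (lean-2 GEN-19, ours)

Venture-side (OURS).  Cell `lqcd-flow` (pub-lqcd), unit `pub-lqcd-lean-2-g19`, 2026-08-25.  The one-line bridge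
used by the direct conveyor floors of chapter R (`Scaling/ReplicaExchangeFrozenColdDirect`) and the star floor of
chapter G (`Scaling/ReplicaExchangeStarFloor`): the Literature's Lemma 13.7 (`SpectralGapVariational`, PROVED) says
the gap is attained by a mean-zero unit-norm eigenfunction `g`; testing the Poincaré inequality on `g` gives the
floor.  (The Literature's `DensityDecomposition.le_spectralGapR_of_poincare` is the same statement for `Gap_R` under
a half-mass witness; here the reversible `Gap` and no witness beyond `|X| ≥ 2`.)

## What is proved

* **`le_spectralGap_of_poincare`** — `π > 0` a probability vector, `P` row-stochastic and `π`-reversible, `|X| ≥ 2`: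
  `(∀ f, c·Var_π(f) ≤ 𝓔_P(f)) → c ≤ spectralGap π P`; **`le_spectralGap_of_poincare_meanZero`** — it suffices to
  test mean-zero `f`.

Literature grade (cell rule): TEXTBOOK STEP (Levin–Peres–Wilmer §13.2), NEW TYPING; nothing cited as a fact; no new
bib keys.
-/

noncomputable section

open Finset
open Literature.Probability.MarkovChains

namespace Summit.Ventures.LatticeQCDFlow.Scaling

variable {X : Type*} [Fintype X]

/-- **`(∀ f, c·Var_π(f) ≤ 𝓔_P(f)) ⇒ c ≤ Gap(P)`** for a reversible `P` w.r.t. a positive probability vector (`|X| ≥ 2`):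
test the inequality on the minimiser of Lemma 13.7. [ours] -/
theorem le_spectralGap_of_poincare [Nontrivial X] {π : X → ℝ} (hπ : ∀ x, 0 < π x) (hπ1 : ∑ x, π x = 1)
    {P : Matrix X X ℝ} (hP : IsRowStochastic P) (hDB : DetailedBalance π P) {c : ℝ}
    (hc : ∀ f : X → ℝ, c * lawVariance π f ≤ dirichletForm π P f) : c ≤ spectralGap π P := by
  obtain ⟨g, hg0, hg1, hE, -⟩ := exists_eigenfunction_spectralGap hπ hπ1 hP hDB
  have hvar : lawVariance π g = 1 := by
    have hmean : lawMean π g = 0 := hg0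
    unfold lawVariance
    rw [hmean]
    unfold piInner at hg1
    rw [← hg1]
    exact sum_congr rfl fun x _ => by ring
  have h := hc g
  rw [hvar, mul_one, hE] at h
  exact h

/-- **It suffices to test mean-zero functions:** `(∀ f, E_π f = 0 → c·Var_π(f) ≤ 𝓔_P(f)) ⇒ c ≤ Gap(P)`. [ours] -/
theorem le_spectralGap_of_poincare_meanZero [Nontrivial X] {π : X → ℝ} (hπ : ∀ x, 0 < π x) (hπ1 : ∑ x, π x = 1)
    {P : Matrix X X ℝ} (hP : IsRowStochastic P) (hDB : DetailedBalance π P) {c : ℝ}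
    (hc : ∀ f : X → ℝ, lawMean π f = 0 → c * lawVariance π f ≤ dirichletForm π P f) : c ≤ spectralGap π P := by
  obtain ⟨g, hg0, hg1, hE, -⟩ := exists_eigenfunction_spectralGap hπ hπ1 hP hDB
  have hmean : lawMean π g = 0 := hg0
  have hvar : lawVariance π g = 1 := by
    unfold lawVariance
    rw [hmean]
    unfold piInner at hg1
    rw [← hg1]
    exact sum_congr rfl fun x _ => by ring
  have h := hc g hmean
  rw [hvar, mul_one, hE] at h
  exact h

end Summit.Ventures.LatticeQCDFlow.Scaling

end
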